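import Literature.Analysis.UnboundedOperators.LinearizedBoltzmann
import HarnessLib

/-!
# Proofs for `LinearizedBoltzmann`: strict positivity of the variational Dirichlet form

Companion of `Literature/Analysis/UnboundedOperators/LinearizedBoltzmann.lean` (prelude C8); see
also the sibling `LinearizedBoltzmannProofs.lean`, which discharges
`dirichletFormInv_nonneg_of_orthogonal` unconditionally (`Real.iSup_nonneg'`).
The prelude defines, for a linearised collision operator `L` and a source `A`,
`dirichletFormInv L A = ⨆ g : temperateGrowth E, (2⟪A, g⟫_M + ⟪g, L g⟫_M)` (a real `iSup`, junk
value `0` when the family is unbounded above) and vendors as named facts (D-0014)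

* `bddAbove_range_dirichlet_of_orthogonal` — the family is bounded above when `A ⊥_M` collision
  invariants (this is the hard-sphere spectral gap, Baranger–Mouhot 2005 Thm 1.1, in disguise);
* `dirichletFormInv_pos_of_orthogonal_of_ne_zero` — `⟪A, (-L)⁻¹ A⟫_M > 0` for `A ≠ 0`
  (CIP 1994 §7.2).

Unlike non-negativity, strict positivity cannot hold through the junk value: `0 < ⨆ g, f g`
forces `BddAbove (range f)` under the `Real.sSup` convention, so the positivity fact contains the
boundedness fact. Here we prove, sorry-free, everything in it that is *not* the spectral gap:

* `isOpenPosMeasure_stdGaussian` — the Maxwellian measure `M dv = stdGaussian E` charges every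
  nonempty open set;
* `integrable_one_add_norm_pow_stdGaussian`, `integrable_stdGaussian_of_hasTemperateGrowth` —
  functions of temperate growth are `M`-integrable (Gaussian moments of all orders,
  `ProbabilityTheory.IsGaussian.memLp_id`);
* `maxwellianInner_self_pos` — `‖A‖²_M = ∫ A² dM > 0` for a non-zero `A` of temperate growth;
* `linearizedCollisionOp_const_mul`, `hardSphereLinearizedOp_const_mul`,
  `maxwellianInner_const_mul_left/right` — homogeneity (valid for Bochner integrals without any
  integrability hypothesis);
* `dirichletFormInv_pos_of_orthogonal_of_ne_zero_of_bddAbove` — the positivity fact follows from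
  `bddAbove_range_dirichlet_of_orthogonal` (test function `g = ε A` with
  `ε = ‖A‖²_M / (|⟪A, L A⟫_M| + 1)`, CIP 1994 §7.2).

Consequently the discharge `dirichletFormInv_pos_of_orthogonal_of_ne_zero_holds` is the one-liner
`dirichletFormInv_pos_of_orthogonal_of_ne_zero_of_bddAbove` applied to
`bddAbove_range_dirichlet_of_orthogonal_holds`, once the boundedness fact (equivalently the
spectral gap `le_neg_maxwellianInner_hardSphereLinearizedOp_of_orthogonal` plus the symmetry
`maxwellianInner_linearizedCollisionOp_comm`) has been discharged.

Sources: Cercignani–Illner–Pulvirenti, *The Mathematical Theory of Dilute Gases* (1994) §7.1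
(1.8)–(1.10), p. 192, and §7.2, Thm 7.2.1, p. 197 (self-adjoint, non-positive, null space = the
collision invariants) and Thm 7.2.5, p. 201 (`0` is isolated in `σ(L)`).

Mathlib anchors: `ProbabilityTheory.stdGaussian`, `ProbabilityTheory.IsGaussian.memLp_id`,
`ProbabilityTheory.gaussianReal_absolutelyContinuous'`, `Continuous.isOpenPosMeasure_map`,
`MeasureTheory.integral_pos_iff_support_of_nonneg`, `MeasureTheory.integral_const_mul`,
`lt_ciSup_iff`.
-/

open MeasureTheory Metric Real ProbabilityTheory Module
open scoped InnerProductSpace ENNReal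

namespace Literature.Analysis.UnboundedOperators

open Literature.MathematicalPhysics.KineticTheory (collide)

noncomputable section

variable {E : Type*} [NormedAddCommGroup E] [InnerProductSpace ℝ E] [FiniteDimensional ℝ E]
  [MeasurableSpace E] [BorelSpace E]

/-! ### The Maxwellian measure: full support and moments -/

/-- The standard Gaussian measure (`M dv`) on a finite-dimensional real inner product space gives
positive mass to every nonempty open set: it is the image of a product of one-dimensional
Gaussians (each mutually absolutely continuous with Lebesgue measure) under a continuous linear
surjection. Stated as a theorem, not an instance, to stay clear of Mathlib's instance table.
[folklore] -/
theorem isOpenPosMeasure_stdGaussian : (stdGaussian E).IsOpenPosMeasure := by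
  haveI : (gaussianReal 0 1).IsOpenPosMeasure :=
    (gaussianReal_absolutelyContinuous' 0 one_ne_zero).isOpenPosMeasure
  rw [stdGaussian]
  refine Continuous.isOpenPosMeasure_map (by fun_prop) fun v => ?_
  exact ⟨fun i => (stdOrthonormalBasis ℝ E).repr v i, (stdOrthonormalBasis ℝ E).sum_repr v⟩

/-- `(1 + |v|)^k` is integrable against the Maxwellian: Gaussian measures have moments of all
orders (Fernique; `ProbabilityTheory.IsGaussian.memLp_id`). [folklore] -/
theorem integrable_one_add_norm_pow_stdGaussian (k : ℕ) :
    Integrable (fun v : E => (1 + ‖v‖) ^ k) (stdGaussian E) := by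
  have h0 : MemLp (fun v : E => ‖v‖) (k : ℝ≥0∞) (stdGaussian E) :=
    (IsGaussian.memLp_id (stdGaussian E) k (ENNReal.natCast_ne_top k)).norm
  have h1 : MemLp (fun v : E => 1 + ‖v‖) (k : ℝ≥0∞) (stdGaussian E) :=
    (memLp_const (1 : ℝ)).add h0
  refine h1.integrable_norm_pow'.congr (ae_of_all _ fun v => ?_)
  change ‖1 + ‖v‖‖ ^ k = (1 + ‖v‖) ^ k
  rw [Real.norm_of_nonneg (by positivity)]

/-- A function of temperate growth (`|f(v)| ≤ C (1 + |v|)^k`, `f` smooth) is integrable against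
the Maxwellian `M dv = stdGaussian E`. [folklore] -/
theorem integrable_stdGaussian_of_hasTemperateGrowth {f : E → ℝ}
    (hf : Function.HasTemperateGrowth f) : Integrable f (stdGaussian E) := by
  obtain ⟨k, C, hC⟩ := hf.2 0
  have hbound : ∀ v, ‖f v‖ ≤ C * (1 + ‖v‖) ^ k := fun v => by
    simpa [norm_iteratedFDeriv_zero] using hC v
  exact Integrable.mono' ((integrable_one_add_norm_pow_stdGaussian k).const_mul C)
    hf.1.continuous.aestronglyMeasurable (ae_of_all _ hbound)

/-- `‖A‖²_M = ⟪A, A⟫_M = ∫ A² dM > 0` for a non-zero function `A` of temperate growth: `A²` is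
continuous, integrable, non-negative and positive on a nonempty open set, which the Maxwellian
charges (CIP 1994 §7.1, the scalar product (1.8), p. 192). [cite: CIP1994, §7.1 (1.8) p. 192] -/
theorem maxwellianInner_self_pos {A : E → ℝ} (hA : A ∈ temperateGrowth E) (hA0 : A ≠ 0) :
    0 < maxwellianInner A A := by
  haveI := isOpenPosMeasure_stdGaussian (E := E)
  have hA' : Function.HasTemperateGrowth A := hA
  have hint : Integrable (fun v => A v * A v) (stdGaussian E) :=
    integrable_stdGaussian_of_hasTemperateGrowth (hA'.mul hA')
  unfold maxwellianInner
  rw [integral_pos_iff_support_of_nonneg (fun v => mul_self_nonneg (A v)) hint]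
  have hsupp : Function.support (fun v => A v * A v) = Function.support A := by
    ext v
    simp [Function.mem_support]
  rw [hsupp]
  exact hA'.1.continuous.isOpen_support.measure_pos _ (Function.support_nonempty_iff.2 hA0)

/-! ### Homogeneity of the collision operator and of the pairing -/

/-- Homogeneity of the linearised collision operator, `L_B (c g) = c L_B g`, valid for the
Bochner integrals defining `linearizedCollisionOp` without any integrability assumption
(CIP 1994 §7.1 (1.6), p. 192: `L` is linear). [cite: CIP1994, §7.1 (1.6) p. 192] -/
theorem linearizedCollisionOp_const_mul (B : E × E → sphere (0 : E) 1 → ℝ) (c : ℝ)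
    (g : E → ℝ) :
    linearizedCollisionOp B (fun v => c * g v) = fun v => c * linearizedCollisionOp B g v := by
  funext v
  simp only [linearizedCollisionOp]
  have h : ∀ (w : E) (ω : sphere (0 : E) 1),
      B (v, w) ω * (c * g (collide ω (v, w)).1 +
        c * g (collide ω (v, w)).2 - c * g v - c * g w) =
      c * (B (v, w) ω * (g (collide ω (v, w)).1 +
        g (collide ω (v, w)).2 - g v - g w)) := by
    intro w ω; ring
  simp_rw [h, integral_const_mul]

/-- Homogeneity of the linearised hard-sphere operator, `L (c g) = c L g`
(CIP 1994 §7.1 (1.6), p. 192). [cite: CIP1994, §7.1 (1.6) p. 192] -/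
theorem hardSphereLinearizedOp_const_mul (c : ℝ) (g : E → ℝ) :
    hardSphereLinearizedOp (fun v => c * g v) = fun v => c * hardSphereLinearizedOp g v :=
  linearizedCollisionOp_const_mul _ c g

omit [BorelSpace E] in
/-- `⟪c g, h⟫_M = c ⟪g, h⟫_M` (no integrability needed; CIP 1994 §7.1 (1.8)). [folklore] -/
theorem maxwellianInner_const_mul_left (c : ℝ) (g h : E → ℝ) :
    maxwellianInner (fun v => c * g v) h = c * maxwellianInner g h := by
  simp only [maxwellianInner, mul_assoc, integral_const_mul]

omit [BorelSpace E] in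
/-- `⟪g, c h⟫_M = c ⟪g, h⟫_M` (no integrability needed; CIP 1994 §7.1 (1.8)). [folklore] -/
theorem maxwellianInner_const_mul_right (c : ℝ) (g h : E → ℝ) :
    maxwellianInner g (fun v => c * h v) = c * maxwellianInner g h := by
  simp only [maxwellianInner, mul_left_comm _ c, integral_const_mul]

/-! ### Strict positivity, conditionally on `bddAbove_range_dirichlet_of_orthogonal` -/

/-- `⟪A, (-L)⁻¹ A⟫_M > 0` for a non-zero `A` of temperate growth `M`-orthogonal to the collision
invariants, *given* the boundedness fact `bddAbove_range_dirichlet_of_orthogonal`: with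
`a = ‖A‖²_M > 0` (`maxwellianInner_self_pos`) and `b = ⟪A, L A⟫_M`, the test function `g = ε A`,
`ε = a / (|b| + 1)`, gives `2⟪A, g⟫_M + ⟪g, L g⟫_M = 2 ε a + ε² b ≥ ε (2a - ε |b|) > ε a > 0`
(CIP 1994 §7.2, Thm 7.2.1, p. 197; the argument sketched in the docstring of the fact).
[cite: CIP1994, §7.2 Thm 7.2.1 p. 197] -/
theorem dirichletFormInv_pos_of_orthogonal_of_ne_zero_of_bddAbove
    (hbdd : bddAbove_range_dirichlet_of_orthogonal (E := E)) :
    dirichletFormInv_pos_of_orthogonal_of_ne_zero (E := E) := by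
  intro hE A hA horth hA0
  have ha : 0 < maxwellianInner A A := maxwellianInner_self_pos hA hA0
  set a := maxwellianInner A A with ha_def
  set b := maxwellianInner A (hardSphereLinearizedOp A) with hb_def
  set ε := a / (|b| + 1) with hε_def
  have hb1 : 0 < |b| + 1 := by positivity
  have hε : 0 < ε := div_pos ha hb1
  have hεb : ε * |b| < a := by
    have : ε * (|b| + 1) = a := by rw [hε_def]; field_simp
    nlinarith
  have hmem : (fun v => ε * A v) ∈ temperateGrowth E :=
    (Function.HasTemperateGrowth.const ε).mul hA
  haveI : Nonempty (temperateGrowth E) := ⟨0⟩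
  unfold dirichletFormInv
  refine (lt_ciSup_iff (hbdd hE hA horth)).2 ⟨⟨fun v => ε * A v, hmem⟩, ?_⟩
  show 0 < 2 * maxwellianInner A (fun v => ε * A v) +
    maxwellianInner (fun v => ε * A v) (hardSphereLinearizedOp fun v => ε * A v)
  rw [hardSphereLinearizedOp_const_mul, maxwellianInner_const_mul_right,
    maxwellianInner_const_mul_left, maxwellianInner_const_mul_right, ← ha_def, ← hb_def]
  have h3 : ε * (ε * |b|) < ε * a := mul_lt_mul_of_pos_left hεb hε
  have h4 : ε * (ε * -|b|) ≤ ε * (ε * b) :=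
    mul_le_mul_of_nonneg_left (mul_le_mul_of_nonneg_left (neg_abs_le b) hε.le) hε.le
  nlinarith [mul_pos hε ha]

end

end Literature.Analysis.UnboundedOperators
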